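/-
Origin: expansion seat `prover-pub-hodgecm-own-htheta-g2-0`, handover #H42 (author htheta-x1-g2) 2026-08-21T14:16:06Z md5 8ef3d1ce1555 sha256 183a8f90b8c5dc9c3a1eaf10ee818dd1137ef3a0c5375ab1139afa90370eefbf (186 l.; NEW additive MODEL leaf: `HermSpace3.transposeAt_transposeAt` :49, `periodNV_face_anyEmb_R2J` :93 (any admissible surface embedding via axioms-3's transposeAt re-presentation), record `periodThmF_r20JBUARM` :128 = (picardCMUniverse …).PeriodThmF BY NAME, `exists_facePeriod_admissible_r20JBUARM` :147, `exists_facePeriod_free_r20JBUARM` :165; imports FacePeriodR2J only; rc 0 5 s 0∕0∕0 default heartbeats; axioms trio 5∕5 log farm-g2/logs/ax_thmf.log 6b224cc6b45a) NAMES: HodgeCM.HermSpace3.transposeAt_transposeAt HodgeCM.Model.periodNV_face_anyEmb_R2J HodgeCM.Model.periodThmF_r20JBUARM HodgeCM.Model.exists_facePeriod_admissible_r20JBUARM HodgeCM.Model.exists_facePeriod_free_r20JBUARM (`HOME/pub-hodgecm-own-htheta/stage82/HodgeCM/Model/FacePeriodThmF.lean`, md5 8ef3d1ce1555, 186 lines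);
landed by the p-seat packager p gen 32 (p-g32) in gate run 81 as `HodgeCM/Model/FacePeriodThmF.lean` (verbatim).
-/
/-
Copyright (c) 2026 the pub-hodgecm formalisation cell (harness21).  New file, not vendored.  x1 work file (a draft until own-htheta kits it).
Origin: seat `prover-pub-hodgecm-htheta-x1-g2-0` (unit pub-hodgecm-htheta-x1 GEN 2, HODGE SURGE extra prover x1 UNDER own-htheta, item (vi) lineage;
coordinator ruling 2026-08-21T13:01:49Z), 2026-08-21 — LEAF 2, the additive sequel of x1 g2's `Model/FacePeriodR2J.lean` (FACEPERIOD v1 35863282ebfe):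
THE NON-CANONICAL SURFACE EMBEDDING SERVED, hence PKG `Universe.PeriodThmF` (`Geometry/Statements.lean`:74 — EVERY admissible `ι₁`, EVERY `V`) BY NAME
for the record's model universe, modulo the record's two cited binder groups.  Target in PKG: `HodgeCM/Model/FacePeriodThmF.lean` (NEW additive leaf;
imports `HodgeCM.Model.FacePeriodR2J` only — axioms-3's `Model/PerLOfCanonical` (RUN 41) is in its closure; nothing imports this file).  KERNEL ONLY:
theorems, no proof holes, no `def`, nothing new cited, NOT an E term; nothing here is a claim of the manuscripts under adjudication; HC_CM is NOT proved.

WHAT IT IS.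
§1 `HermSpace3.transposeAt_transposeAt` — re-presenting twice is the identity (`Hmᵀᵀ = Hm`).
§2 `periodNV_face_anyEmb_R2J` (generic pins `hA hGR hGR₀ hGR₁ hGR₂ hGR₃ μ`, generic fourth row `h₃`): for `F` Galois CM with `6 ≤ [F:ℚ]`, a face `f`, ANY
   admissible surface embedding `ι₀` (canonical or not) and ANY `V₀ : HermSpace3 F ι₀`: `U.PeriodNV ι₀ V₀ F f.psi ι₀`, from `hR` [DM82 6.20] and the
   [Liu21 4.18 r8] sentence at the canonical embeddings OF `F`.  Off the representative (`(mk ι₀).embedding = conjugate ι₀`): leaf 1's σ-decoupled head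
   `periodNV_faceσ_R2J` at the CANONICAL surface embedding `conjugate ι₀` with eigen-embedding `σ := ι₀` (`j := conjAut F`) on the transposed space
   `V₀.transposeAt (conjugate ι₀) _` (axioms-3 `HermSpace3.transposeAt`, `Model/PerLOfCanonical.lean`:115), then axioms-3's re-presentation
   `Universe.periodNV_of_pms_eq` (:85) over `universeOf_pms_transposeAt` (:248) — the SAME `Var` `U.pms F ι₀ V₀ Γ` — and §1.  This is
   `perL_of_perLCanonical` (:257) read at a face, with the eigen-embedding held fixed.
§3 RECORD INSTANTIATION («JBUARM»'s two groups `hGRU` [GR91 3.1.1] + `h418` [Liu21 4.18 r8, CITED-AS-CONSEQUENCE], `hA`∕`hR` the vendored `_holds`,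
   `μ := ArchSideTerm.muSlotZero`, `h₃ := cmAbelianVarietyRealised_of_eigenbasis hHD hI h₃`):
   **`periodThmF_r20JBUARM (hHD hI h₁ h₃) (hGRU) (h418) : U.PeriodThmF`** — the PACKAGE's face period statement AS TYPED (rfwf Thm 4.1 in admissible
   form = `PerLFace` of the tree's display, read in the package: every Galois CM `F` with `6 ≤ [F:ℚ]`, every rank-four face, every admissible `ι₁`, every
   `V`), for the RECORD's model universe; and the two ∃-shapes the tree's consumers display: `exists_facePeriod_admissible_r20JBUARM` (shape of
   `CorCM/FacePeriodWitnesses.lean`:189 `hc_cm_closed_of_exists_facePeriod` — surface embedding admissible, `σ` free) and `exists_facePeriod_free_r20JBUARM`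
   (shape of `CorCM/B01/Transposition/AssemblyFree.lean`:191 `hc_cm_closed_of_exists_facePeriod_free`).  Over the PACKAGE universe
   `HodgeCM.Model.picardCMUniverse …`, NOT the tree's `Summit.….Model.picardCMUniverse …` (venue (vi-0)); closes no tree item.
-/
import Summits.HodgeConjecture.HodgeCM.Model.FacePeriodR2J_2

set_option autoImplicit false

noncomputable section

open scoped Matrix
open NumberField NumberField.InfinitePlace NumberField.ComplexEmbedding
open Literature.NumberTheory.GelbartRogawski1991.UnitaryDualPair

namespace HodgeCM

open CMTypeOps (conjAut comp_conjAut)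

/-! ## §1 Re-presenting twice is the identity -/

namespace HermSpace3

variable {L : CMField} {ι₀ ι₁ : L →+* ℂ}

/-- `(Vᵀ at ι₀)ᵀ at ι₁ = V`: the Gram matrix is `Hmᵀᵀ = Hm`, the three proof fields are propositions. [folklore] -/
theorem transposeAt_transposeAt (V : HermSpace3 L ι₁) (h : conjugate ι₀ = ι₁) (h' : conjugate ι₁ = ι₀) :
    (V.transposeAt ι₀ h).transposeAt ι₁ h' = V := by
  cases V
  simp only [transposeAt, Matrix.transpose_transpose]

end HermSpace3

namespace Model

open HodgeCM.Model.ArchSideTerm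
open Literature.AlgebraicGeometry.HodgeTheory
open Literature.NumberTheory.Automorphic.PicardCM
open Literature.NumberTheory.Transcendental (Arapura2012_Cor_15_4_6)

/-! ## §2 Any admissible surface embedding (generic pins) -/

section Generic

variable (hHD : exists_isReal_hodgeModel) (hI : hodgePQ_independent_of_hodgeModel)
  (h₁ : BallQuotientUniformised) (h₃ : CMAbelianVarietyRealised) (hA : Arapura2012_Cor_15_4_6)
    (hGR : ∀ {L : CMField} {ι₁ : L →+* ℂ} (V : HermSpace3 L ι₁) (c : SeesawCtx L),
      (cmSplittingDatum (L : Type) finProdFinEquiv (frameD V) (frameD_real V) (frameD_ne V) (dW c.D) (dW_real c.D)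
        (dW_ne c.D)).CompatibleSplitting)
    (hGR₀ : ∀ {L : CMField} {ι₁ : L →+* ℂ} (V : HermSpace3 L ι₁) (c : SeesawCtx L),
      (cmSplittingDatum (L : Type) (e₁) (frameD V) (frameD_real V) (frameD_ne V) (lineVec (L : Type) (dW c.D 0))
        (fun _ => dW_real c.D 0) (fun _ => dW_ne c.D 0)).CompatibleSplitting)
    (hGR₁ : ∀ {L : CMField} {ι₁ : L →+* ℂ} (V : HermSpace3 L ι₁) (c : SeesawCtx L),
      (cmSplittingDatum (L : Type) (e₁) (frameD V) (frameD_real V) (frameD_ne V) (lineVec (L : Type) (dW c.D 1))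
        (fun _ => dW_real c.D 1) (fun _ => dW_ne c.D 1)).CompatibleSplitting)
    (hGR₂ : ∀ {L : CMField} {ι₁ : L →+* ℂ} (V : HermSpace3 L ι₁) (c : SeesawCtx L),
      (cmSplittingDatum (L : Type) (e₁) (frameD V) (frameD_real V) (frameD_ne V) (lineVec (L : Type) (dW' c.D 0))
        (fun _ => dW'_real c.D 0) (fun _ => dW'_ne c.D 0)).CompatibleSplitting)
    (hGR₃ : ∀ {L : CMField} {ι₁ : L →+* ℂ} (V : HermSpace3 L ι₁) (c : SeesawCtx L),
      (cmSplittingDatum (L : Type) (e₁) (frameD V) (frameD_real V) (frameD_ne V) (lineVec (L : Type) (dW' c.D 1))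
        (fun _ => dW'_real c.D 1) (fun _ => dW'_ne c.D 1)).CompatibleSplitting)
    (μ : ∀ {L : CMField}, SeesawCtx L → Fin 4 → NumberField.InfinitePlace L → ℤ)

include hGR hGR₀ hGR₁ hGR₂ hGR₃ μ

/-- **THE FACE PERIOD HEAD AT ANY ADMISSIBLE SURFACE EMBEDDING** (generic pins): `F` Galois CM with `6 ≤ [F:ℚ]`, `f` a rank-four face, `ι₀` admissible
(canonical OR NOT), `V₀ : HermSpace3 F ι₀` arbitrary; inputs `hR` [DM82 Thm 6.20] and the [Liu21 Thm 4.18 r8] sentence at every CANONICAL embedding of `F`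
and every hermitian 3-space there: `U.PeriodNV ι₀ V₀ F f.psi ι₀`.  At the representative: leaf 1's `periodNV_face_R2J`.  Off it: leaf 1's
`periodNV_faceσ_R2J` at surface embedding `conjugate ι₀`, eigen-embedding `ι₀`, `j := conjAut F`, space `V₀.transposeAt (conjugate ι₀) _`, re-presented on
the SAME surface by axioms-3's `periodNV_of_pms_eq` ∕ `universeOf_pms_transposeAt` and `transposeAt_transposeAt`. [folklore] -/
theorem periodNV_face_anyEmb_R2J (hR : DeligneMilne1982_Thm_6_20_full) (F : CMField) [IsGalois ℚ F] (h6 : 6 ≤ Module.finrank ℚ F) (f : Face F)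
    {ι₀ : F →+* ℂ} (hadm : f.Admissible ι₀) (V₀ : HermSpace3 F ι₀)
    (h418 : ∀ {ι₁ : F →+* ℂ} (V : HermSpace3 F ι₁), (NumberField.InfinitePlace.mk ι₁).embedding = ι₁ → ∀ a₀ : LiuIndex.RealScalar F,
      (liuDictionaryPin hHD hI h₁ h₃ hA V (LiuIndex.I V (LiuIndex.repAt a₀) (LiuIndex.muLiu ι₁ LiuIndex.GramClass.rep))
          (LiuIndex.line V (LiuIndex.repAt a₀) (LiuIndex.muLiu ι₁ LiuIndex.GramClass.rep))).Thm418C) :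
    (picardCMUniverse hHD hI h₁ h₃).PeriodNV ι₀ V₀ F f.psi ι₀ := by
  rcases NumberField.InfinitePlace.embedding_mk_eq ι₀ with hc | hc
  · exact periodNV_face_R2J hHD hI h₁ h₃ hA hGR hGR₀ hGR₁ hGR₂ hGR₃ μ hR F h6 f hadm hc V₀ (h418 V₀ hc)
  · -- `hc : (mk ι₀).embedding = conjugate ι₀`: work at the representative `conjugate ι₀`, eigen-embedding `ι₀`
    have hrep : (NumberField.InfinitePlace.mk (conjugate ι₀)).embedding = conjugate ι₀ := by
      rw [mk_conjugate_eq, hc]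
    have hj : (conjugate ι₀).comp (conjAut F).toRingHom = ι₀ := by
      rw [comp_conjAut]
      exact involutive_conjugate _ ι₀
    obtain ⟨Γ₁, Fm, α, hα, hp⟩ := periodNV_faceσ_R2J hHD hI h₁ h₃ hA hGR hGR₀ hGR₁ hGR₂ hGR₃ μ hR F h6 f hadm
      (conjAut F).toRingHom hj hrep (V₀.transposeAt (conjugate ι₀) (involutive_conjugate _ ι₀)) (h418 _ hrep)
    have hP := Universe.periodNV_of_pms_eq _ (Γ₁.conjTransposeAt ι₀ rfl) Γ₁
      (universeOf_pms_transposeAt hHD hI (ballQuotientUniformisedDatum_of h₁) h₃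
        (V₀.transposeAt (conjugate ι₀) (involutive_conjugate _ ι₀)) Γ₁ ι₀ rfl) ⟨Fm, α, hα, hp⟩
    rwa [HermSpace3.transposeAt_transposeAt] at hP

end Generic

/-! ## §3 RECORD INSTANTIATION — PKG `Universe.PeriodThmF` by name, and the tree consumers' ∃-shapes -/

section Record

variable (hHD : exists_isReal_hodgeModel) (hI : hodgePQ_independent_of_hodgeModel)
  (h₁ : BallQuotientUniformised) (h₃ : CMAbelianVarietyEigenbasisRealised)

/-- **THE PACKAGE'S FACE PERIOD STATEMENT `Universe.PeriodThmF` FOR THE RECORD'S MODEL UNIVERSE, MODULO THE RECORD'S CITED MANIFEST**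
(`Geometry/Statements.lean`:74: every Galois CM field `F` with `6 ≤ [F:ℚ]`, every rank-four face, EVERY admissible `ι₁`, EVERY `V : HermSpace3 F ι₁` —
the statement `Assembly.periodThmF` ∕ `StubTree.periodThmF_holds` derive from the open input `RealisationExistsFace`; here derived instead from
«JBUARM»'s two binder groups `hGRU` [GR91 Prop. 3.1.1] + `h418` [Liu 2021 Thm 4.18, reading r8, CITED-AS-CONSEQUENCE] VERBATIM, nothing else).
NOT an E term; NOT a tree theorem; HC_CM is NOT proved by this. [folklore] -/
theorem periodThmF_r20JBUARM
    (hGRU : ∀ (L : Type) [Field L] [NumberField L] [NumberField.IsCMField L] {N M n : ℕ} (e : Fin N × Fin M ≃ Fin n)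
      (dV : Fin N → L) (hdV : ∀ i, NumberField.IsCMField.complexConj L (dV i) = dV i) (hdV0 : ∀ i, dV i ≠ 0)
      (dW : Fin M → L) (hdW : ∀ i, NumberField.IsCMField.complexConj L (dW i) = dW i) (hdW0 : ∀ i, dW i ≠ 0),
      (cmSplittingDatum L e dV hdV hdV0 dW hdW hdW0).CompatibleSplitting)
    (h418 : ∀ {L : CMField} {ι₁ : L →+* ℂ} (V : HermSpace3 L ι₁), (NumberField.InfinitePlace.mk ι₁).embedding = ι₁ → ∀ a₀ : LiuIndex.RealScalar L,
      (liuDictionaryPin hHD hI h₁ (cmAbelianVarietyRealised_of_eigenbasis hHD hI h₃) Literature.NumberTheory.Transcendental.arapura2012_cor_15_4_6_holds V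
          (LiuIndex.I V (LiuIndex.repAt a₀) (LiuIndex.muLiu ι₁ LiuIndex.GramClass.rep))
          (LiuIndex.line V (LiuIndex.repAt a₀) (LiuIndex.muLiu ι₁ LiuIndex.GramClass.rep))).Thm418C) :
    (picardCMUniverse hHD hI h₁ (cmAbelianVarietyRealised_of_eigenbasis hHD hI h₃)).PeriodThmF :=
  fun F hG h6 f ι₁ hadm V => by
    haveI := hG
    exact periodNV_face_anyEmb_R2J hHD hI h₁ (cmAbelianVarietyRealised_of_eigenbasis hHD hI h₃) Literature.NumberTheory.Transcendental.arapura2012_cor_15_4_6_holds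
      (@SInstance.GRU.hGR hGRU) (@SInstance.GRU.hGR₀ hGRU) (@SInstance.GRU.hGR₁ hGRU) (@SInstance.GRU.hGR₂ hGRU) (@SInstance.GRU.hGR₃ hGRU) @ArchSideTerm.muSlotZero
      Literature.AlgebraicGeometry.HodgeTheory.deligneMilne1982_Thm_6_20_full_holds F h6 f hadm V (fun V' hcan' => h418 V' hcan')

/-- **THE ∃-SHAPE OF `CorCM/FacePeriodWitnesses.lean`:189** (`hc_cm_closed_of_exists_facePeriod`: surface embedding admissible, eigen-embedding free),
read in the package over the record's model universe: one application of `periodThmF_r20JBUARM` at any admissible `ι₁` (`StubTree.admissible_exists`) and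
Landherr's space (`StubTree.landherr_exists`), `σ := ι₁`. [folklore] -/
theorem exists_facePeriod_admissible_r20JBUARM
    (hGRU : ∀ (L : Type) [Field L] [NumberField L] [NumberField.IsCMField L] {N M n : ℕ} (e : Fin N × Fin M ≃ Fin n)
      (dV : Fin N → L) (hdV : ∀ i, NumberField.IsCMField.complexConj L (dV i) = dV i) (hdV0 : ∀ i, dV i ≠ 0)
      (dW : Fin M → L) (hdW : ∀ i, NumberField.IsCMField.complexConj L (dW i) = dW i) (hdW0 : ∀ i, dW i ≠ 0),
      (cmSplittingDatum L e dV hdV hdV0 dW hdW hdW0).CompatibleSplitting)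
    (h418 : ∀ {L : CMField} {ι₁ : L →+* ℂ} (V : HermSpace3 L ι₁), (NumberField.InfinitePlace.mk ι₁).embedding = ι₁ → ∀ a₀ : LiuIndex.RealScalar L,
      (liuDictionaryPin hHD hI h₁ (cmAbelianVarietyRealised_of_eigenbasis hHD hI h₃) Literature.NumberTheory.Transcendental.arapura2012_cor_15_4_6_holds V
          (LiuIndex.I V (LiuIndex.repAt a₀) (LiuIndex.muLiu ι₁ LiuIndex.GramClass.rep))
          (LiuIndex.line V (LiuIndex.repAt a₀) (LiuIndex.muLiu ι₁ LiuIndex.GramClass.rep))).Thm418C) :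
    ∀ (F : CMField), IsGalois ℚ F → 6 ≤ Module.finrank ℚ F → ∀ f : Face F,
      ∃ ι₁ : F →+* ℂ, f.Admissible ι₁ ∧ ∃ (V : HermSpace3 F ι₁) (σ : F →+* ℂ), (picardCMUniverse hHD hI h₁ (cmAbelianVarietyRealised_of_eigenbasis hHD hI h₃)).PeriodNV ι₁ V F f.psi σ :=
  fun F hG h6 f => by
    obtain ⟨ι₁, hι⟩ := StubTree.admissible_exists F h6 f
    obtain ⟨V⟩ := StubTree.landherr_exists F ι₁
    exact ⟨ι₁, hι, V, ι₁, periodThmF_r20JBUARM hHD hI h₁ h₃ hGRU h418 F hG h6 f ι₁ hι V⟩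

/-- **THE ∃-SHAPE OF `CorCM/B01/Transposition/AssemblyFree.lean`:191** (`hc_cm_closed_of_exists_facePeriod_free`: everything free), read in the package
over the record's model universe. [folklore] -/
theorem exists_facePeriod_free_r20JBUARM
    (hGRU : ∀ (L : Type) [Field L] [NumberField L] [NumberField.IsCMField L] {N M n : ℕ} (e : Fin N × Fin M ≃ Fin n)
      (dV : Fin N → L) (hdV : ∀ i, NumberField.IsCMField.complexConj L (dV i) = dV i) (hdV0 : ∀ i, dV i ≠ 0)
      (dW : Fin M → L) (hdW : ∀ i, NumberField.IsCMField.complexConj L (dW i) = dW i) (hdW0 : ∀ i, dW i ≠ 0),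
      (cmSplittingDatum L e dV hdV hdV0 dW hdW hdW0).CompatibleSplitting)
    (h418 : ∀ {L : CMField} {ι₁ : L →+* ℂ} (V : HermSpace3 L ι₁), (NumberField.InfinitePlace.mk ι₁).embedding = ι₁ → ∀ a₀ : LiuIndex.RealScalar L,
      (liuDictionaryPin hHD hI h₁ (cmAbelianVarietyRealised_of_eigenbasis hHD hI h₃) Literature.NumberTheory.Transcendental.arapura2012_cor_15_4_6_holds V
          (LiuIndex.I V (LiuIndex.repAt a₀) (LiuIndex.muLiu ι₁ LiuIndex.GramClass.rep))
          (LiuIndex.line V (LiuIndex.repAt a₀) (LiuIndex.muLiu ι₁ LiuIndex.GramClass.rep))).Thm418C) :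
    ∀ (F : CMField), IsGalois ℚ F → 6 ≤ Module.finrank ℚ F → ∀ f : Face F,
      ∃ (ι₁ : F →+* ℂ) (V : HermSpace3 F ι₁) (σ : F →+* ℂ), (picardCMUniverse hHD hI h₁ (cmAbelianVarietyRealised_of_eigenbasis hHD hI h₃)).PeriodNV ι₁ V F f.psi σ :=
  fun F hG h6 f => by
    obtain ⟨ι₁, hι, V, σ, h⟩ := exists_facePeriod_admissible_r20JBUARM hHD hI h₁ h₃ hGRU h418 F hG h6 f
    exact ⟨ι₁, V, σ, h⟩

end Record

end Model

end HodgeCM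

end
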